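/- Free-seat work of EXTRA WIDTH SEAT `ym-line-cbag-p1-w4` (prover-ym-line-cbag-p1-w4-g2-0), route `EguchiKawaiDirectionLadder`
(ideator ym-idea-2, LINE 8), crux `TripleSmallBallMargin` (stmt-QuantumFields-27724), toward stub (b) `OffBlockDecoupling`
(ingredient 3/5 of the honest reduction (b♯) in the sizing note `sizing-27724-stubB.md`: the law `ν` with INDEPENDENT HAAR
DIAGONAL BLOCKS that `EguchiKawaiDirectionLadderHaarAbsorption.lean` absorbs).  ROUTE-INDEPENDENT (no Theses import).
Nothing here bears on the Yang–Mills mass gap. -/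
import Summits.QuantumFields.YangMills.Theorems.EguchiKawaiDirectionLadderBlockCompression
import HarnessLib

/-!
# Route `EguchiKawaiDirectionLadder`: block-diagonal unitaries for a labelling, and the block Haar law

For a labelling `ℓ : Fin N → Fin m` of the indices (blocks = fibres `{i // ℓ i = a}`), this file defines

* `blockDiag ℓ V` — the `N × N` block-diagonal matrix with diagonal blocks `V a : Matrix {ℓ = a} {ℓ = a} ℂ`
  (Mathlib's `blockDiagonal'` re-indexed along `Equiv.sigmaFiberEquiv ℓ`), with its algebra (`blockDiag_mul`,
  `blockDiag_one`, `blockDiag_conjTranspose`), its blocks (`toBlock_blockDiag_same = V a`, `toBlock_blockDiag_ne = 0`) and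
  the compression rule `(M · blockDiag ℓ V).toBlock p (ℓ = a) = M.toBlock p (ℓ = a) · V a` (`toBlock_mul_blockDiag`), dually
  `(blockDiag ℓ V · M).toBlock (ℓ = a) q = V a · M.toBlock (ℓ = a) q`;
* `blockDiagUnitary ℓ : (Π a, U({ℓ = a})) →* U(N)` — the block-diagonal EMBEDDING of the product of the block unitary groups
  (a continuous, measurable monoid hom; `coe_blockDiagUnitary`);
* `blockHaar ℓ := ⊗_a Haar_{U({ℓ = a})}` and its image `blockLaw ℓ : Measure (UN N)` — the probability law of a block-diagonal
  unitary with INDEPENDENT HAAR DIAGONAL BLOCKS (`lintegral_blockLaw`, `blockLaw_apply`); linkwise, `blockLawEK ℓ d :=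
  ⊗_{μ < d} blockLaw ℓ` on `EKConfig d N`.  By `ekHaar_mconv (blockLawEK ℓ d)` (HaarAbsorption) a Haar configuration times
  an independent `blockLawEK`-distributed one is again Haar: this is the block factorisation `U_μ = W_μ · ι(V_μ)` under
  which `(U_μ)_{aa} = (W_μ)_{aa} · V_{μ,a}` (`toBlock_mul_blockDiag`) with `V_{μ,a}` Haar on `U(n_a)`, all independent.

HONEST FRAMING: definitions and bookkeeping; no small-ball estimate.  The route bears on the barrier-ledger fact
`EguchiKawaiBreakdown` only.
-/

set_option autoImplicit false

noncomputable section

open MeasureTheory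
open scoped Matrix ENNReal
open Literature.Barriers.QuantumFields

namespace Summit.QuantumFields.YangMills.Theorems.EguchiKawaiDirectionLadder

variable {N m : ℕ}

/-! ### §1 Block-diagonal matrices for a labelling -/

/-- A Σ-index over the fibres of `ℓ` with a prescribed label: `⟨ℓ j, ⟨j, rfl⟩⟩ = ⟨a, ⟨j, hj⟩⟩`. -/
theorem sigma_fiber_mk_eq (ℓ : Fin N → Fin m) {a : Fin m} (j : Fin N) (hj : ℓ j = a) :
    (⟨ℓ j, ⟨j, rfl⟩⟩ : Σ b : Fin m, {i : Fin N // ℓ i = b}) = ⟨a, ⟨j, hj⟩⟩ := by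
  subst hj; rfl

/-- **The block-diagonal matrix** of a family of diagonal blocks `V a : Matrix {ℓ = a} {ℓ = a} ℂ` (`a : Fin m`):
Mathlib's `blockDiagonal' V` on `Σ a, {ℓ = a}`, re-indexed to `Fin N` along `Equiv.sigmaFiberEquiv ℓ`. -/
def blockDiag (ℓ : Fin N → Fin m) (V : (a : Fin m) → Matrix {i : Fin N // ℓ i = a} {i : Fin N // ℓ i = a} ℂ) :
    Matrix (Fin N) (Fin N) ℂ :=
  Matrix.reindex (Equiv.sigmaFiberEquiv ℓ) (Equiv.sigmaFiberEquiv ℓ) (Matrix.blockDiagonal' V)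

/-- Entries of `blockDiag`: `(blockDiag ℓ V) i j = blockDiagonal' V ⟨ℓ i, i⟩ ⟨ℓ j, j⟩`. -/
theorem blockDiag_apply (ℓ : Fin N → Fin m) (V : (a : Fin m) → Matrix {i : Fin N // ℓ i = a} {i : Fin N // ℓ i = a} ℂ)
    (i j : Fin N) : blockDiag ℓ V i j = Matrix.blockDiagonal' V ⟨ℓ i, ⟨i, rfl⟩⟩ ⟨ℓ j, ⟨j, rfl⟩⟩ := rfl

/-- Off-block entries vanish. -/
theorem blockDiag_apply_of_ne (ℓ : Fin N → Fin m)
    (V : (a : Fin m) → Matrix {i : Fin N // ℓ i = a} {i : Fin N // ℓ i = a} ℂ) {i j : Fin N} (h : ℓ i ≠ ℓ j) :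
    blockDiag ℓ V i j = 0 := by
  rw [blockDiag_apply]
  exact Matrix.blockDiagonal'_apply_ne V _ _ h

/-- In-block entries are the entries of the block. -/
theorem blockDiag_apply_of_eq (ℓ : Fin N → Fin m)
    (V : (a : Fin m) → Matrix {i : Fin N // ℓ i = a} {i : Fin N // ℓ i = a} ℂ) {a : Fin m} {i j : Fin N}
    (hi : ℓ i = a) (hj : ℓ j = a) : blockDiag ℓ V i j = V a ⟨i, hi⟩ ⟨j, hj⟩ := by
  rw [blockDiag_apply, sigma_fiber_mk_eq ℓ i hi, sigma_fiber_mk_eq ℓ j hj, Matrix.blockDiagonal'_apply_eq]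

/-- `blockDiag` is multiplicative (blockwise products). -/
theorem blockDiag_mul (ℓ : Fin N → Fin m)
    (V W : (a : Fin m) → Matrix {i : Fin N // ℓ i = a} {i : Fin N // ℓ i = a} ℂ) :
    blockDiag ℓ (fun a => V a * W a) = blockDiag ℓ V * blockDiag ℓ W := by
  unfold blockDiag
  rw [Matrix.blockDiagonal'_mul]
  simp only [Matrix.reindex_apply, Matrix.submatrix_mul_equiv]

/-- `blockDiag ℓ 1 = 1`. -/
theorem blockDiag_one (ℓ : Fin N → Fin m) :
    blockDiag ℓ (fun a => (1 : Matrix {i : Fin N // ℓ i = a} {i : Fin N // ℓ i = a} ℂ)) = 1 := by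
  unfold blockDiag
  have h : (fun a => (1 : Matrix {i : Fin N // ℓ i = a} {i : Fin N // ℓ i = a} ℂ)) =
      (1 : (a : Fin m) → Matrix {i : Fin N // ℓ i = a} {i : Fin N // ℓ i = a} ℂ) := rfl
  rw [h, Matrix.blockDiagonal'_one]
  simp only [Matrix.reindex_apply, Matrix.submatrix_one_equiv]

/-- `blockDiag` commutes with the conjugate transpose (blockwise). -/
theorem blockDiag_conjTranspose (ℓ : Fin N → Fin m)
    (V : (a : Fin m) → Matrix {i : Fin N // ℓ i = a} {i : Fin N // ℓ i = a} ℂ) :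
    (blockDiag ℓ V)ᴴ = blockDiag ℓ (fun a => (V a)ᴴ) := by
  unfold blockDiag
  simp only [Matrix.reindex_apply, Matrix.conjTranspose_submatrix, Matrix.blockDiagonal'_conjTranspose]

/-- **The diagonal block `a` of `blockDiag ℓ V` is `V a`.** -/
theorem toBlock_blockDiag_same (ℓ : Fin N → Fin m)
    (V : (a : Fin m) → Matrix {i : Fin N // ℓ i = a} {i : Fin N // ℓ i = a} ℂ) (a : Fin m) :
    (blockDiag ℓ V).toBlock (fun i => ℓ i = a) (fun i => ℓ i = a) = V a := by
  ext ⟨i, hi⟩ ⟨j, hj⟩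
  rw [Matrix.toBlock_apply, blockDiag_apply_of_eq ℓ V hi hj]

/-- Off-diagonal blocks of `blockDiag ℓ V` vanish. -/
theorem toBlock_blockDiag_ne (ℓ : Fin N → Fin m)
    (V : (a : Fin m) → Matrix {i : Fin N // ℓ i = a} {i : Fin N // ℓ i = a} ℂ) {a b : Fin m} (hab : a ≠ b) :
    (blockDiag ℓ V).toBlock (fun i => ℓ i = a) (fun i => ℓ i = b) = 0 := by
  ext ⟨i, hi⟩ ⟨j, hj⟩
  rw [Matrix.toBlock_apply, Matrix.zero_apply]
  exact blockDiag_apply_of_ne ℓ V (by rw [hi, hj]; exact hab)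

/-- A general block of `blockDiag ℓ V` against an arbitrary row predicate: columns of label `a` only see `V a`:
`(blockDiag ℓ V).toBlock p (ℓ = a) i j = [ℓ i = a] · V a i j`. -/
theorem toBlock_blockDiag_apply (ℓ : Fin N → Fin m)
    (V : (a : Fin m) → Matrix {i : Fin N // ℓ i = a} {i : Fin N // ℓ i = a} ℂ) (p : Fin N → Prop) (a : Fin m)
    (i : {i : Fin N // p i}) (j : {j : Fin N // ℓ j = a}) :
    (blockDiag ℓ V).toBlock p (fun k => ℓ k = a) i j =
      if h : ℓ (i : Fin N) = a then V a ⟨i, h⟩ j else 0 := by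
  rw [Matrix.toBlock_apply]
  split_ifs with h
  · obtain ⟨j, hj⟩ := j
    exact blockDiag_apply_of_eq ℓ V h hj
  · exact blockDiag_apply_of_ne ℓ V (by rw [j.2]; exact h)

/-- **Compression rule (right factor)**: `(M · blockDiag ℓ V).toBlock p (ℓ = a) = M.toBlock p (ℓ = a) · V a` — right
multiplication by a block-diagonal matrix acts on the column block `a` through `V a` alone. -/
theorem toBlock_mul_blockDiag (ℓ : Fin N → Fin m) (M : Matrix (Fin N) (Fin N) ℂ)
    (V : (a : Fin m) → Matrix {i : Fin N // ℓ i = a} {i : Fin N // ℓ i = a} ℂ) (p : Fin N → Prop) (a : Fin m) :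
    (M * blockDiag ℓ V).toBlock p (fun i => ℓ i = a) = M.toBlock p (fun i => ℓ i = a) * V a := by
  rw [toBlock_mul_eq_sum_fiber ℓ p (fun i => ℓ i = a) M (blockDiag ℓ V)]
  rw [Finset.sum_eq_single a]
  · rw [toBlock_blockDiag_same]
  · intro b _ hba
    rw [toBlock_blockDiag_ne ℓ V hba, Matrix.mul_zero]
  · intro h; exact absurd (Finset.mem_univ a) h

/-- **Compression rule (left factor)**: `(blockDiag ℓ V · M).toBlock (ℓ = a) q = V a · M.toBlock (ℓ = a) q`. -/
theorem toBlock_blockDiag_mul (ℓ : Fin N → Fin m) (M : Matrix (Fin N) (Fin N) ℂ)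
    (V : (a : Fin m) → Matrix {i : Fin N // ℓ i = a} {i : Fin N // ℓ i = a} ℂ) (q : Fin N → Prop) (a : Fin m) :
    (blockDiag ℓ V * M).toBlock (fun i => ℓ i = a) q = V a * M.toBlock (fun i => ℓ i = a) q := by
  rw [toBlock_mul_eq_sum_fiber ℓ (fun i => ℓ i = a) q (blockDiag ℓ V) M]
  rw [Finset.sum_eq_single a]
  · rw [toBlock_blockDiag_same]
  · intro b _ hba
    rw [toBlock_blockDiag_ne ℓ V hba.symm, Matrix.zero_mul]
  · intro h; exact absurd (Finset.mem_univ a) h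

/-! ### §2 The block-diagonal embedding of `Π_a U({ℓ = a})` into `U(N)` -/

/-- The product of the block unitary groups (the block-diagonal subgroup, abstractly). -/
abbrev BlockUnitaries (ℓ : Fin N → Fin m) : Type :=
  (a : Fin m) → Matrix.unitaryGroup {i : Fin N // ℓ i = a} ℂ

/-- `blockDiag` of unitary blocks is unitary. -/
theorem blockDiag_mem_unitaryGroup (ℓ : Fin N → Fin m) (V : BlockUnitaries ℓ) :
    blockDiag ℓ (fun a => (V a : Matrix {i : Fin N // ℓ i = a} {i : Fin N // ℓ i = a} ℂ)) ∈ UN N := by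
  rw [Matrix.mem_unitaryGroup_iff', Matrix.star_eq_conjTranspose, blockDiag_conjTranspose, ← blockDiag_mul]
  have h : (fun a => (V a : Matrix {i : Fin N // ℓ i = a} {i : Fin N // ℓ i = a} ℂ)ᴴ *
      (V a : Matrix {i : Fin N // ℓ i = a} {i : Fin N // ℓ i = a} ℂ)) =
      fun a => (1 : Matrix {i : Fin N // ℓ i = a} {i : Fin N // ℓ i = a} ℂ) := by
    funext a
    have := Matrix.mem_unitaryGroup_iff'.mp (V a).2
    rwa [Matrix.star_eq_conjTranspose] at this
  rw [h, blockDiag_one]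

/-- **The block-diagonal embedding** `ι_ℓ : Π_a U({ℓ = a}) →* U(N)`. -/
def blockDiagUnitary (ℓ : Fin N → Fin m) : BlockUnitaries ℓ →* UN N where
  toFun V := ⟨blockDiag ℓ (fun a => (V a : Matrix {i : Fin N // ℓ i = a} {i : Fin N // ℓ i = a} ℂ)),
    blockDiag_mem_unitaryGroup ℓ V⟩
  map_one' := by
    apply Subtype.ext
    simp only [Pi.one_apply, OneMemClass.coe_one]
    exact blockDiag_one ℓ
  map_mul' V W := by
    apply Subtype.ext
    simp only [Pi.mul_apply, Matrix.UnitaryGroup.mul_val]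
    exact blockDiag_mul ℓ _ _

/-- The matrix of `ι_ℓ V` is `blockDiag ℓ V`. -/
theorem coe_blockDiagUnitary (ℓ : Fin N → Fin m) (V : BlockUnitaries ℓ) :
    ((blockDiagUnitary ℓ V : UN N) : Matrix (Fin N) (Fin N) ℂ) =
      blockDiag ℓ (fun a => (V a : Matrix {i : Fin N // ℓ i = a} {i : Fin N // ℓ i = a} ℂ)) := rfl

/-- The diagonal block `a` of a link times `ι_ℓ V` is the block of the link times `V a`:
`(W · ι_ℓ V)_{p,a} = W_{p,a} · V a`. -/
theorem toBlock_coe_mul_blockDiagUnitary (ℓ : Fin N → Fin m) (W : UN N) (V : BlockUnitaries ℓ) (p : Fin N → Prop)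
    (a : Fin m) :
    ((W * blockDiagUnitary ℓ V : UN N) : Matrix (Fin N) (Fin N) ℂ).toBlock p (fun i => ℓ i = a) =
      (W : Matrix (Fin N) (Fin N) ℂ).toBlock p (fun i => ℓ i = a) *
        (V a : Matrix {i : Fin N // ℓ i = a} {i : Fin N // ℓ i = a} ℂ) := by
  rw [Matrix.UnitaryGroup.mul_val, coe_blockDiagUnitary, toBlock_mul_blockDiag]

/-- The block-diagonal matrix depends continuously on the blocks. -/
theorem continuous_blockDiag_coe (ℓ : Fin N → Fin m) :
    Continuous fun V : BlockUnitaries ℓ =>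
      blockDiag ℓ (fun a => (V a : Matrix {i : Fin N // ℓ i = a} {i : Fin N // ℓ i = a} ℂ)) := by
  have h : Continuous fun V : BlockUnitaries ℓ =>
      fun a => (V a : Matrix {i : Fin N // ℓ i = a} {i : Fin N // ℓ i = a} ℂ) :=
    continuous_pi fun a => continuous_subtype_val.comp (continuous_apply a)
  exact (h.matrix_blockDiagonal').matrix_submatrix _ _

/-- The embedding is continuous. -/
theorem continuous_blockDiagUnitary (ℓ : Fin N → Fin m) : Continuous (blockDiagUnitary ℓ) :=
  Continuous.subtype_mk (continuous_blockDiag_coe ℓ) _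

/-- Matrices over any finite index type form a second-countable space (the `Pi` instance seen through `Matrix`);
recorded as a theorem (used via `haveI`). -/
theorem secondCountableTopology_matrix (n : Type) [Fintype n] :
    SecondCountableTopology (Matrix n n ℂ) :=
  inferInstanceAs (SecondCountableTopology (n → n → ℂ))

/-- The block unitary groups are second countable (used via `haveI`). -/
theorem secondCountableTopology_blockUnitary (ℓ : Fin N → Fin m) (a : Fin m) :
    SecondCountableTopology (Matrix.unitaryGroup {i : Fin N // ℓ i = a} ℂ) := by
  haveI := secondCountableTopology_matrix {i : Fin N // ℓ i = a}
  exact TopologicalSpace.Subtype.secondCountableTopology _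

/-- The embedding is measurable (Borel structures on both sides). -/
theorem measurable_blockDiagUnitary (ℓ : Fin N → Fin m) : Measurable (blockDiagUnitary ℓ) := by
  haveI : ∀ a : Fin m, SecondCountableTopology (Matrix.unitaryGroup {i : Fin N // ℓ i = a} ℂ) :=
    secondCountableTopology_blockUnitary ℓ
  exact (continuous_blockDiagUnitary ℓ).measurable

/-! ### §3 The block Haar law: independent Haar diagonal blocks -/

/-- `⊗_a Haar_{U({ℓ = a})}`: independent Haar-distributed diagonal blocks. -/
def blockHaar (ℓ : Fin N → Fin m) : Measure (BlockUnitaries ℓ) :=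
  Measure.pi fun a => Literature.MathematicalPhysics.QuantumFieldTheory.haarProbability
    (Matrix.unitaryGroup {i : Fin N // ℓ i = a} ℂ)

/-- `blockHaar ℓ` is a probability measure. -/
theorem isProbabilityMeasure_blockHaar (ℓ : Fin N → Fin m) : IsProbabilityMeasure (blockHaar ℓ) := by
  unfold blockHaar; infer_instance

/-- **The block law** on `U(N)`: the law of `ι_ℓ V` for `V ~ ⊗_a Haar` — a block-diagonal unitary with independent Haar
diagonal blocks. -/
def blockLaw (ℓ : Fin N → Fin m) : Measure (UN N) :=
  (blockHaar ℓ).map (blockDiagUnitary ℓ)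

/-- `blockLaw ℓ` is a probability measure. -/
theorem isProbabilityMeasure_blockLaw (ℓ : Fin N → Fin m) : IsProbabilityMeasure (blockLaw ℓ) := by
  haveI := isProbabilityMeasure_blockHaar ℓ
  exact Measure.isProbabilityMeasure_map (measurable_blockDiagUnitary ℓ).aemeasurable

/-- Integration against the block law = integration over independent Haar blocks. -/
theorem lintegral_blockLaw (ℓ : Fin N → Fin m) {f : UN N → ℝ≥0∞} (hf : Measurable f) :
    ∫⁻ U, f U ∂blockLaw ℓ = ∫⁻ V, f (blockDiagUnitary ℓ V) ∂blockHaar ℓ := by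
  unfold blockLaw
  rw [lintegral_map hf (measurable_blockDiagUnitary ℓ)]

/-- The block law of a measurable event = the `⊗ Haar` measure of its preimage under the embedding. -/
theorem blockLaw_apply (ℓ : Fin N → Fin m) {S : Set (UN N)} (hS : MeasurableSet S) :
    blockLaw ℓ S = blockHaar ℓ (blockDiagUnitary ℓ ⁻¹' S) := by
  unfold blockLaw
  rw [Measure.map_apply (measurable_blockDiagUnitary ℓ) hS]

/-- Linkwise block law on Eguchi–Kawai configurations: `⊗_{μ < d} blockLaw ℓ` (each link an independent block-diagonal
unitary with independent Haar blocks). -/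
def blockLawEK (ℓ : Fin N → Fin m) (d : ℕ) : Measure (EKConfig d N) :=
  Measure.pi fun _ : Fin d => blockLaw ℓ

/-- `blockLawEK ℓ d` is a probability measure — so `ekHaar_mconv (blockLawEK ℓ d)` (HaarAbsorption) applies:
`U · V ~ ekHaar` for `U ~ ekHaar`, `V ~ blockLawEK ℓ d` independent. -/
theorem isProbabilityMeasure_blockLawEK (ℓ : Fin N → Fin m) (d : ℕ) : IsProbabilityMeasure (blockLawEK ℓ d) := by
  haveI := isProbabilityMeasure_blockLaw ℓ
  unfold blockLawEK; infer_instance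

end Summit.QuantumFields.YangMills.Theorems.EguchiKawaiDirectionLadder

end
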